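import Summits.AtomisticToContinuum.Crystallization.Theorems.ChartedZeroExcessLayeredLatticeLiouvilleZZZYRCXO

/-!
# ChartedZeroExcessLayeredLatticeLiouville · ZZZYRCXP — THE θ⁰ KERNEL: COMPLETENESS BY COUNTING AND THE ASSEMBLY TO `KernelSlabSound`
(decomp-a2c hand-1 g55; target stmt-AtomisticToContinuum-26636 JS-D near reader; critic r1854 (A) / r1857 (A) work-list item 2, second half)

§1 helpers: sorted cut points are monotone in `getD` form; an EMPTY code list cannot pass a window below `2 160 000` (`6·600²`), so the slab
certificate itself excludes empty chords; letters `≤ 2` of the ℕ word in both currencies (`regN`, lens-2's `regW_bounds` hypothesis for `wordZ`).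
§2 ★ COMPLETENESS OF ONE RESIDUE `residue_complete`: for base residue `mX` with sorted cut points `κ₀ < … < κ_S`, slab certificates
`slabAcc … (κ_s, κ_{s+1}] … = some T_s`, strictly increasing last codes and `#chords_s = countWins[s]` (the count file), EVERY lattice site `y` with
`κ₀ < n9((0,mX), y) ≤ κ_S` is the far site of a decoded chord: the site lies in the scanned box (RCXM `inBox_of_n9_le`), its offsets are located in
some window `s` (RCXN `slabIdx_exists`), the window's site set has at most `countWins[s] = #chords_s` elements while the chords' far sites are
`#chords_s` DISTINCT members of it (sortedness makes the window of a chord unique) — pigeonhole (RCXN `cover_of_card_le_map`).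
§3 ★★ THE ASSEMBLY `kernelSlabSound_of_slabs`: for a word `w` (letters ≤ 2, period `p ∣ 612`, `p ≤ 601`), a global window `(lo, hi]` with
`hi < 2 160 000` inside the box `(GB, MB ≤ 600)`, and per residue `r < p` a sorted cut list from `lo` to `hi` with one certified slab + count per window:
`KernelSlabSound (wordZ w) lo hi P9 E (slabData p cuts cs) (slabTR p cuts T) (slabTN p cuts T)` — lens-2's kernel contract (RCX §5) with the data
= all decoded chords and the integer tables = the residue/slab sums of the kernel's key-wise sums at `codeK k`.
Imports RCXO; 0 sorry.  All `[folklore]`.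
-/

namespace Summit.AtomisticToContinuum.Crystallization.Theorems.ChartedZeroExcessLayeredLatticeLiouville.ThetaKernel

open scoped BigOperators

/-! ## §1 helpers -/

/-- sorted cut points are monotone (`getD` form). [folklore] -/
theorem getD_mono_of_sorted {cuts : List ℕ} (hsort : cuts.Pairwise (· < ·)) {i j : ℕ} (hij : i ≤ j) (hj : j < cuts.length) :
    cuts.getD i 0 ≤ cuts.getD j 0 := by
  rcases hij.lt_or_eq with hlt | rfl
  · rw [List.getD_eq_getElem _ _ (hlt.trans hj), List.getD_eq_getElem _ _ hj]
    exact (List.pairwise_iff_getElem.mp hsort i j (hlt.trans hj) hj hlt).le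
  · exact le_rfl

/-- `n9Z` is at least six times the squared layer offset. [folklore] -/
theorem six_mul_sq_le_n9Z (v : ℤ × ℤ × ℤ) : 6 * v.2.2 * v.2.2 ≤ n9Z v := by
  unfold n9Z; nlinarith [sq_nonneg (2 * v.1 + v.2.1), sq_nonneg v.2.1]

/-- ★ an EMPTY code list cannot pass a slab window below `2 160 000 = 6·600²` (its `Y` would decode to layer `−600`). [folklore] -/
theorem ne_nil_of_window {w : List ℕ} {mX : ℕ} {hi : ℤ} (hhi : hi < 2160000) {c : List ℕ} (h : n9Z (chordE w w.length mX c) ≤ hi) : c ≠ [] := by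
  rintro rfl
  have h6 := six_mul_sq_le_n9Z (chordE w w.length mX [])
  have hv : (chordE w w.length mX []).2.2 = ((0 : ℕ) : ℤ) - ((600 + mX : ℕ) : ℤ) := rfl
  rw [hv] at h6
  push_cast at h6
  nlinarith

/-- letters `≤ 2` of the word ⇒ the kernel's letters `regN ≤ 2`. [folklore] -/
theorem regN_le_two {w : List ℕ} (hw2 : ∀ n ∈ w, n ≤ 2) (p x : ℕ) : regN w p x ≤ 2 := by
  unfold regN
  rcases lt_or_ge ((x + 12) % p) w.length with hlt | hge
  · rw [List.getD_eq_getElem _ _ hlt]; exact hw2 _ (List.getElem_mem hlt)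
  · rw [List.getD_eq_default _ _ hge]; norm_num

/-- letters `≤ 2` of the word ⇒ lens-2's letter hypothesis for `wordZ w`. [folklore] -/
theorem wordZ_bounds {w : List ℕ} (hw2 : ∀ n ∈ w, n ≤ 2) : ∀ c ∈ wordZ w, 0 ≤ c ∧ c ≤ 2 := by
  intro c hc
  obtain ⟨n, hn, rfl⟩ := List.mem_map.mp hc
  exact ⟨by positivity, by exact_mod_cast hw2 n hn⟩

/-- `n9W` from the based site `(0, mX)` in the box-lemma form: `qhex(3γ₀ + d, 3γ₁ + d) + 6Δm²` with `d` the letter difference. [folklore] -/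
theorem n9W_based (wd : List ℤ) (mX : ℕ) (y : Cell 2 × ℤ) :
    n9W wd (((0 : Cell 2), (mX : ℤ)), y) =
      (3 * y.1 0 + (regW wd y.2 - regW wd mX)) * (3 * y.1 0 + (regW wd y.2 - regW wd mX)) +
        (3 * y.1 0 + (regW wd y.2 - regW wd mX)) * (3 * y.1 1 + (regW wd y.2 - regW wd mX)) +
        (3 * y.1 1 + (regW wd y.2 - regW wd mX)) * (3 * y.1 1 + (regW wd y.2 - regW wd mX)) + 6 * (y.2 - mX) * (y.2 - mX) := by
  simp only [n9W, refW0, refW1, Pi.zero_apply]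
  ring

/-- ★ a site ideal-near the based site lies in the scanned box (RCXM `inBox_of_n9_le` in lens-2's currency). [folklore] -/
theorem inBox_of_n9W_le {w : List ℕ} (hw2 : ∀ n ∈ w, n ≤ 2) {mX GB MB : ℕ} {hi : ℤ} {y : Cell 2 × ℤ}
    (h9 : n9W (wordZ w) (((0 : Cell 2), (mX : ℤ)), y) ≤ hi) (hGB : 4 * hi < 3 * (3 * (GB : ℤ) + 1) ^ 2) (hMB : hi < 6 * ((MB : ℤ) + 1) ^ 2) :
    |y.1 0| ≤ GB ∧ |y.1 1| ≤ GB ∧ |y.2 - mX| ≤ MB := by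
  have hb := wordZ_bounds hw2
  have h1 := regW_bounds hb y.2
  have h2 := regW_bounds hb (mX : ℤ)
  rw [n9W_based] at h9
  exact inBox_of_n9_le (y.1 0) (y.1 1) (y.2 - mX) _ hi GB MB (abs_le.mpr ⟨by linarith, by linarith⟩) h9 hGB hMB

/-! ## §2 completeness of one residue -/

/-- the lattice site of the box offsets `(a, b, c)` for base residue `mX`: `(a − GB, b − GB, mX + c − MB)`. -/
def siteOfOffs (GB MB mX : ℕ) (t : ℕ × ℕ × ℕ) : Cell 2 × ℤ := (![(t.1 : ℤ) - GB, (t.2.1 : ℤ) - GB], (mX : ℤ) + t.2.2 - MB)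

/-- the SITES of window `s`: images of the scanned offsets located in window `s`. -/
noncomputable def windowSites (w : List ℕ) (mX GB MB : ℕ) (cuts : List ℕ) (s : ℕ) : Finset (Cell 2 × ℤ) :=
  (((boxTriples GB MB).filter fun abc => slabIdx cuts (u9N w mX GB MB abc.1 abc.2.1 abc.2.2) = some s).map (siteOfOffs GB MB mX)).toFinset

/-- the window's site set has at most `countWins[s]` elements. [folklore] -/
theorem card_windowSites_le (w : List ℕ) (mX GB MB : ℕ) (cuts : List ℕ) {s : ℕ} (hs : s + 1 < cuts.length) :
    (windowSites w mX GB MB cuts s).card ≤ (countWins w mX GB MB cuts).getD s 0 := by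
  unfold windowSites
  rw [getD_countWins w mX GB MB cuts s hs]
  exact (List.toFinset_card_le _).trans (by rw [List.length_map])

/-- ★ the count program's `n9` at the offsets of an in-box site `y` IS `n9W` from the based site `(0, mX)` (letters by `regW_wordZ`). [folklore] -/
theorem u9N_offs {w : List ℕ} (hw2 : ∀ n ∈ w, n ≤ 2) (hp : w.length ∣ 612) {mX GB MB : ℕ} (hMB : MB ≤ 600) {y : Cell 2 × ℤ}
    (h0 : |y.1 0| ≤ GB) (h1 : |y.1 1| ≤ GB) (hm : |y.2 - mX| ≤ MB) :
    ((u9N w mX GB MB (y.1 0 + GB).toNat (y.1 1 + GB).toNat (y.2 - mX + MB).toNat : ℕ) : ℤ) = n9W (wordZ w) (((0 : Cell 2), (mX : ℤ)), y) := by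
  rw [abs_le] at h0 h1 hm
  rw [u9N_eq w mX GB MB _ _ _ (regN_le_two hw2 w.length), n9W_based]
  have e0 : (((y.1 0 + GB).toNat : ℕ) : ℤ) = y.1 0 + GB := Int.toNat_of_nonneg (by omega)
  have e1 : (((y.1 1 + GB).toNat : ℕ) : ℤ) = y.1 1 + GB := Int.toNat_of_nonneg (by omega)
  have em : (((y.2 - mX + MB).toNat : ℕ) : ℤ) = y.2 - mX + MB := Int.toNat_of_nonneg (by omega)
  have hidx : 600 + mX + (y.2 - mX + MB).toNat - MB = (y.2 + 600).toNat := by omega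
  have hrY : (regN w w.length (600 + mX + (y.2 - mX + MB).toNat - MB) : ℤ) = regW (wordZ w) y.2 := by
    rw [hidx, ← regW_wordZ hp, Int.toNat_of_nonneg (by omega)]; ring_nf
  have hrX : (regN w w.length (600 + mX) : ℤ) = regW (wordZ w) mX := by
    rw [← regW_wordZ hp]; push_cast; ring_nf
  simp only
  rw [hrY, hrX, e0, e1, em]
  ring

/-- an in-box site whose offsets the locator puts in window `s` belongs to `windowSites s`. [folklore] -/
theorem mem_windowSites {w : List ℕ} {mX GB MB : ℕ} {cuts : List ℕ} {s : ℕ} {y : Cell 2 × ℤ}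
    (h0 : |y.1 0| ≤ GB) (h1 : |y.1 1| ≤ GB) (hm : |y.2 - mX| ≤ MB)
    (hidx : slabIdx cuts (u9N w mX GB MB (y.1 0 + GB).toNat (y.1 1 + GB).toNat (y.2 - mX + MB).toNat) = some s) :
    y ∈ windowSites w mX GB MB cuts s := by
  rw [abs_le] at h0 h1 hm
  unfold windowSites
  rw [List.mem_toFinset, List.mem_map]
  refine ⟨((y.1 0 + GB).toNat, (y.1 1 + GB).toNat, (y.2 - mX + MB).toNat), ?_, ?_⟩
  · rw [List.mem_filter]
    exact ⟨mem_boxTriples.mpr ⟨by omega, by omega, by omega⟩, by simpa using hidx⟩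
  · obtain ⟨γ, m⟩ := y
    simp only [siteOfOffs, Prod.mk.injEq]
    refine ⟨?_, ?_⟩
    · funext i
      fin_cases i
      · simp only [Fin.zero_eta, Matrix.cons_val_zero]
        simp only at h0; omega
      · simp only [Fin.mk_one, Matrix.cons_val_one, Matrix.cons_val_zero]
        simp only at h1; omega
    · simp only at hm; omega

section Residue

variable {w : List ℕ} {P9 E mX GB MB : ℕ} {cuts : List ℕ} {t0 : ℕ → PT} {cs : ℕ → List (List ℕ)} {T : ℕ → List (ℕ × ℕ × ℕ)}

/-- ★★ COMPLETENESS OF ONE RESIDUE by counting: every site `y` with `κ₀ < n9((0,mX), y) ≤ κ_S` is the far site of a chord decoded from some slab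
of the residue. [folklore] -/
theorem residue_complete (hw2 : ∀ n ∈ w, n ≤ 2) (hp : w.length ∣ 612) (hmX : mX < 601) (hMB : MB ≤ 600)
    (hlen : 2 ≤ cuts.length) (hsort : cuts.Pairwise (· < ·))
    (hGB : 4 * (cuts.getD (cuts.length - 1) 0 : ℤ) < 3 * (3 * (GB : ℤ) + 1) ^ 2) (hMBb : (cuts.getD (cuts.length - 1) 0 : ℤ) < 6 * ((MB : ℤ) + 1) ^ 2)
    (hslab : ∀ s, s + 1 < cuts.length → slabAcc w P9 E mX (cuts.getD s 0) (cuts.getD (s + 1) 0) (t0 s) (cs s) = some (T s))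
    (hstrict : ∀ s, s + 1 < cuts.length → lastCodesStrict (cs s) = true)
    (hcount : ∀ s, s + 1 < cuts.length → (cs s).length = (countWins w mX GB MB cuts).getD s 0)
    (y : Cell 2 × ℤ) (hlo : (cuts.getD 0 0 : ℤ) < n9W (wordZ w) (((0 : Cell 2), (mX : ℤ)), y))
    (hhi : n9W (wordZ w) (((0 : Cell 2), (mX : ℤ)), y) ≤ cuts.getD (cuts.length - 1) 0) :
    ∃ s, s + 1 < cuts.length ∧ ∃ c ∈ cs s, (decodeChord mX c).1 = (((0 : Cell 2), (mX : ℤ)), y) := by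
  have hw := regN_le_two hw2 w.length
  obtain ⟨κ, rest, hcr⟩ : ∃ κ rest, cuts = κ :: rest := by
    cases cuts with
    | nil => simp at hlen
    | cons κ rest => exact ⟨κ, rest, rfl⟩
  have hne : cuts ≠ [] := by rw [hcr]; exact List.cons_ne_nil κ rest
  have hlast : cuts.getLast hne = cuts.getD (cuts.length - 1) 0 := by rw [List.getLast_eq_getElem, List.getD_eq_getElem]
  have hhead : cuts.getD 0 0 = κ := by rw [hcr]; rfl
  -- locate a site of the residue window in some slab window
  have locate : ∀ z : Cell 2 × ℤ, (cuts.getD 0 0 : ℤ) < n9W (wordZ w) (((0 : Cell 2), (mX : ℤ)), z) →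
      n9W (wordZ w) (((0 : Cell 2), (mX : ℤ)), z) ≤ cuts.getD (cuts.length - 1) 0 →
      (|z.1 0| ≤ GB ∧ |z.1 1| ≤ GB ∧ |z.2 - mX| ≤ MB) ∧ ∃ s, s + 1 < cuts.length ∧
        slabIdx cuts (u9N w mX GB MB (z.1 0 + GB).toNat (z.1 1 + GB).toNat (z.2 - mX + MB).toNat) = some s ∧
        (cuts.getD s 0 : ℤ) < n9W (wordZ w) (((0 : Cell 2), (mX : ℤ)), z) ∧ n9W (wordZ w) (((0 : Cell 2), (mX : ℤ)), z) ≤ cuts.getD (s + 1) 0 := by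
    intro z hzlo hzhi
    have hbox := inBox_of_n9W_le hw2 hzhi hGB hMBb
    have hu := u9N_offs hw2 hp hMB hbox.1 hbox.2.1 hbox.2.2
    set u := u9N w mX GB MB (z.1 0 + GB).toNat (z.1 1 + GB).toNat (z.2 - mX + MB).toNat with hudef
    have hκ : κ < u := by
      have : (κ : ℤ) < u := by rw [hu, ← hhead]; exact hzlo
      exact_mod_cast this
    have hL : u ≤ (κ :: rest).getLast (List.cons_ne_nil κ rest) := by
      have h' : u ≤ cuts.getLast hne := by
        have : (u : ℤ) ≤ cuts.getD (cuts.length - 1) 0 := by rw [hu]; exact hzhi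
        rw [hlast]; exact_mod_cast this
      simpa [hcr] using h'
    obtain ⟨s, hs⟩ := slabIdx_exists rest κ u hκ hL
    rw [← hcr] at hs
    obtain ⟨hs1, hslo, hshi⟩ := slabIdx_some cuts u s hs
    refine ⟨hbox, s, hs1, hs, ?_, ?_⟩
    · rw [← hu]; exact_mod_cast hslo
    · rw [← hu]; exact_mod_cast hshi
  obtain ⟨hboxy, s, hs1, hsy, -, -⟩ := locate y hlo hhi
  refine ⟨s, hs1, ?_⟩
  -- the chords of slab `s`: far sites distinct, all in the window's site set
  obtain ⟨H1, -, -⟩ := slabAcc_sound w P9 E mX hw hmX _ _ (t0 s) (cs s) (T s) (hslab s hs1)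
  have hY : ∀ c, (decodeChord mX c).1.2 = siteN (dec3 (lastD c 0)) := fun c => rfl
  have hnd : ((cs s).map fun c => (decodeChord mX c).1.2).Nodup := by
    have key : ((cs s).map fun c => (decodeChord mX c).1.2) = ((cs s).map fun c => lastD c 0).map fun y => siteN (dec3 y) := by
      rw [List.map_map]; rfl
    rw [key]
    exact (nodup_lastCodes_of_strict (hstrict s hs1)).map_on fun a _ b _ hab => dec3_inj (siteN_inj hab)
  have hin : ∀ c ∈ cs s, (decodeChord mX c).1.2 ∈ windowSites w mX GB MB cuts s := by
    intro c hc
    obtain ⟨hclo, hchi, -⟩ := H1 c hc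
    rw [← n9W_decodeChord_fst hp] at hclo hchi
    have hfst : (decodeChord mX c).1 = (((0 : Cell 2), (mX : ℤ)), (decodeChord mX c).1.2) := rfl
    rw [hfst] at hclo hchi
    have hzlo : (cuts.getD 0 0 : ℤ) < n9W (wordZ w) (((0 : Cell 2), (mX : ℤ)), (decodeChord mX c).1.2) :=
      lt_of_le_of_lt (by exact_mod_cast getD_mono_of_sorted hsort (Nat.zero_le s) (by omega)) hclo
    have hzhi : n9W (wordZ w) (((0 : Cell 2), (mX : ℤ)), (decodeChord mX c).1.2) ≤ cuts.getD (cuts.length - 1) 0 :=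
      hchi.trans (by exact_mod_cast getD_mono_of_sorted hsort (by omega) (by omega))
    obtain ⟨hboxc, s', hs1', hs', -, -⟩ := locate _ hzlo hzhi
    have hu := u9N_offs hw2 hp hMB hboxc.1 hboxc.2.1 hboxc.2.2
    have heq : s' = s := by
      refine slabIdx_eq_of_mem_window hsort hs1 ?_ ?_ hs'
      · have : (cuts.getD s 0 : ℤ) < _ := hclo
        rw [← hu] at this; exact_mod_cast this
      · have : _ ≤ (cuts.getD (s + 1) 0 : ℤ) := hchi
        rw [← hu] at this; exact_mod_cast this
    rw [heq] at hs'
    exact mem_windowSites hboxc.1 hboxc.2.1 hboxc.2.2 hs'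
  have hcard : (windowSites w mX GB MB cuts s).card ≤ (cs s).length := by
    rw [hcount s hs1]; exact card_windowSites_le w mX GB MB cuts hs1
  obtain ⟨c, hc, hcy⟩ := cover_of_card_le_map (cs s) (fun c => (decodeChord mX c).1.2) _ hnd hin hcard y
    (mem_windowSites hboxy.1 hboxy.2.1 hboxy.2.2 hsy)
  exact ⟨c, hc, Prod.ext rfl hcy⟩

end Residue

/-! ## §3 the assembly -/

/-- ALL decoded chord data of a word: residues `r < p`, slabs `s < |cuts r| − 1`. -/
def slabData (p : ℕ) (cuts : ℕ → List ℕ) (cs : ℕ → ℕ → List (List ℕ)) : List ChordDatum :=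
  (List.range p).flatMap fun r => (List.range ((cuts r).length - 1)).flatMap fun s => (cs r s).map (decodeChord r)

/-- the summed integer R table at the signed key `k`. -/
def slabTR (p : ℕ) (cuts : ℕ → List ℕ) (T : ℕ → ℕ → List (ℕ × ℕ × ℕ)) (k : ℤ × ℤ × ℤ × ℤ) : ℤ :=
  ∑ r ∈ Finset.range p, ∑ s ∈ Finset.range ((cuts r).length - 1), (tabR (T r s) (codeK k) : ℤ)

/-- the summed integer N table at the signed key `k`. -/
def slabTN (p : ℕ) (cuts : ℕ → List ℕ) (T : ℕ → ℕ → List (ℕ × ℕ × ℕ)) (k : ℤ × ℤ × ℤ × ℤ) : ℤ :=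
  ∑ r ∈ Finset.range p, ∑ s ∈ Finset.range ((cuts r).length - 1), (tabN (T r s) (codeK k) : ℤ)

/-- `thetaR0` / `thetaN0` are additive over concatenation of data. [folklore] -/
theorem theta_append (wd : List ℤ) (cd cd' : List ChordDatum) (k : ℤ × ℤ × ℤ × ℤ) :
    thetaR0 wd (cd ++ cd') k = thetaR0 wd cd k + thetaR0 wd cd' k ∧ thetaN0 wd (cd ++ cd') k = thetaN0 wd cd k + thetaN0 wd cd' k := by
  unfold thetaR0 thetaN0
  simp only [List.map_append, List.sum_append, and_self]

/-- … hence over a `flatMap` indexed by `List.range n` they are `Finset.range` sums. [folklore] -/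
theorem theta_flatMap_range (wd : List ℤ) (f : ℕ → List ChordDatum) (k : ℤ × ℤ × ℤ × ℤ) : ∀ n : ℕ,
    thetaR0 wd ((List.range n).flatMap f) k = ∑ i ∈ Finset.range n, thetaR0 wd (f i) k ∧
      thetaN0 wd ((List.range n).flatMap f) k = ∑ i ∈ Finset.range n, thetaN0 wd (f i) k
  | 0 => by simp [thetaR0, thetaN0]
  | n + 1 => by
    obtain ⟨ihR, ihN⟩ := theta_flatMap_range wd f k n
    rw [List.range_succ, List.flatMap_append, Finset.sum_range_succ, Finset.sum_range_succ]
    obtain ⟨hR, hN⟩ := theta_append wd ((List.range n).flatMap f) ([n].flatMap f) k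
    rw [hR, hN, ihR, ihN]
    simp

/-- ★★★ THE ASSEMBLY: per-residue sorted cut lists from `lo` to `hi`, one certified slab and one count per window ⇒ lens-2's KERNEL CONTRACT
`KernelSlabSound` for the word `wordZ w`, the global window `(lo, hi]`, the decoded data and the summed integer tables. [folklore] -/
theorem kernelSlabSound_of_slabs (w : List ℕ) (P9 E GB MB lo hi : ℕ) (cuts : ℕ → List ℕ) (t0 : ℕ → ℕ → PT)
    (cs : ℕ → ℕ → List (List ℕ)) (T : ℕ → ℕ → List (ℕ × ℕ × ℕ))
    (hw2 : ∀ n ∈ w, n ≤ 2) (hp : w.length ∣ 612) (hp1 : w.length ≤ 601) (hP9 : P9 ≤ 2000000) (hMB : MB ≤ 600) (hhi : hi < 2160000)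
    (hGB : 4 * hi < 3 * (3 * GB + 1) ^ 2) (hMBb : hi < 6 * (MB + 1) ^ 2)
    (hcuts : ∀ r < w.length, 2 ≤ (cuts r).length ∧ (cuts r).Pairwise (· < ·) ∧ (cuts r).getD 0 0 = lo ∧
      (cuts r).getD ((cuts r).length - 1) 0 = hi)
    (hslab : ∀ r < w.length, ∀ s, s + 1 < (cuts r).length →
      slabAcc w P9 E r ((cuts r).getD s 0) ((cuts r).getD (s + 1) 0) (t0 r s) (cs r s) = some (T r s) ∧
      lastCodesStrict (cs r s) = true ∧ (cs r s).length = (countWins w r GB MB (cuts r)).getD s 0) :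
    KernelSlabSound (wordZ w) lo hi P9 E (slabData w.length cuts cs) (slabTR w.length cuts T) (slabTN w.length cuts T) := by
  have hw := regN_le_two hw2 w.length
  have hGBz : 4 * (hi : ℤ) < 3 * (3 * (GB : ℤ) + 1) ^ 2 := by exact_mod_cast hGB
  have hMBz : (hi : ℤ) < 6 * ((MB : ℤ) + 1) ^ 2 := by exact_mod_cast hMBb
  -- per slab: the window sits inside `(lo, hi]`, no chord is empty
  have hwin : ∀ r < w.length, ∀ s, s + 1 < (cuts r).length →
      (lo : ℤ) ≤ ((cuts r).getD s 0 : ℤ) ∧ (((cuts r).getD (s + 1) 0 : ℕ) : ℤ) ≤ (hi : ℤ) := by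
    intro r hr s hs
    obtain ⟨-, hsort, h0, hL⟩ := hcuts r hr
    constructor
    · rw [← h0]; exact_mod_cast getD_mono_of_sorted hsort (Nat.zero_le s) (by omega)
    · rw [← hL]; exact_mod_cast getD_mono_of_sorted hsort (by omega) (by omega)
  have hne : ∀ r < w.length, ∀ s, s + 1 < (cuts r).length → ∀ c ∈ cs r s, c ≠ [] := by
    intro r hr s hs c hc
    obtain ⟨H1, -, -⟩ := slabAcc_sound w P9 E r hw (by omega) _ _ (t0 r s) (cs r s) (T r s) (hslab r hr s hs).1
    have hhi' : (((cuts r).getD (s + 1) 0 : ℕ) : ℤ) < 2160000 := lt_of_le_of_lt (hwin r hr s hs).2 (by exact_mod_cast hhi)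
    exact ne_nil_of_window hhi' (H1 c hc).2.1
  -- membership in the data
  have hmem : ∀ c' ∈ slabData w.length cuts cs, ∃ r, r < w.length ∧ ∃ s, s + 1 < (cuts r).length ∧ c' ∈ (cs r s).map (decodeChord r) := by
    intro c' hc'
    unfold slabData at hc'
    obtain ⟨r, hr, hc'⟩ := List.mem_flatMap.mp hc'
    obtain ⟨s, hs, hc'⟩ := List.mem_flatMap.mp hc'
    rw [List.mem_range] at hr hs
    exact ⟨r, hr, s, by omega, hc'⟩
  refine ⟨⟨fun c' hc' => ?_, ?_, fun x hx0 hxm hxp hxlo hxhi => ?_⟩, fun k => ?_⟩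
  · -- per chord
    obtain ⟨r, hr, s, hs, hc'⟩ := hmem c' hc'
    obtain ⟨h1, h2, h3, h4, h5, h6⟩ := slab_valid hw hp (by omega) hr (hne r hr s hs) (hslab r hr s hs).1 c' hc'
    exact ⟨h1, h2, h3, lt_of_le_of_lt (hwin r hr s hs).1 h4, h5.trans (hwin r hr s hs).2, h6⟩
  · -- distinct based pairs
    unfold slabData
    rw [List.map_flatMap]
    refine List.nodup_flatMap.mpr ⟨fun r hr => ?_, ?_⟩
    · rw [List.mem_range] at hr
      rw [List.map_flatMap]
      refine List.nodup_flatMap.mpr ⟨fun s hs => ?_, ?_⟩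
      · rw [List.mem_range] at hs
        exact slab_nodup (hslab r hr s (by omega)).2.1
      · refine List.pairwise_lt_range.imp_of_mem fun {s s'} hs hs' hss' => ?_
        rw [List.mem_range] at hs hs'
        intro q hq hq'
        simp only at hq hq'
        obtain ⟨c, hc, hcq⟩ := List.mem_map.mp hq
        obtain ⟨c', hc', hcq'⟩ := List.mem_map.mp hq'
        obtain ⟨d, hd, rfl⟩ := List.mem_map.mp hc
        obtain ⟨d', hd', rfl⟩ := List.mem_map.mp hc'
        obtain ⟨H1, -, -⟩ := slabAcc_sound w P9 E r hw (by omega) _ _ (t0 r s) (cs r s) (T r s) (hslab r hr s (by omega)).1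
        obtain ⟨H1', -, -⟩ := slabAcc_sound w P9 E r hw (by omega) _ _ (t0 r s') (cs r s') (T r s') (hslab r hr s' (by omega)).1
        have ha := (H1 d hd).2.1
        have hb := (H1' d' hd').1
        rw [← n9W_decodeChord_fst hp, hcq] at ha
        rw [← n9W_decodeChord_fst hp, hcq'] at hb
        have hmono := getD_mono_of_sorted (hcuts r hr).2.1 (Nat.succ_le_of_lt hss') (by omega : s' < (cuts r).length)
        have : (((cuts r).getD (s + 1) 0 : ℕ) : ℤ) ≤ ((cuts r).getD s' 0 : ℕ) := by exact_mod_cast hmono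
        exact absurd (ha.trans this) (not_le.mpr hb)
    · refine List.pairwise_lt_range.imp_of_mem fun {r r'} hr hr' hrr' => ?_
      intro q hq hq'
      simp only at hq hq'
      obtain ⟨c, hc, hcq⟩ := List.mem_map.mp hq
      obtain ⟨c', hc', hcq'⟩ := List.mem_map.mp hq'
      obtain ⟨s, -, hc⟩ := List.mem_flatMap.mp hc
      obtain ⟨s', -, hc'⟩ := List.mem_flatMap.mp hc'
      obtain ⟨d, -, rfl⟩ := List.mem_map.mp hc
      obtain ⟨d', -, rfl⟩ := List.mem_map.mp hc'
      have h1 : q.1.2 = (r : ℤ) := by rw [← hcq]; rfl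
      have h2 : q.1.2 = (r' : ℤ) := by rw [← hcq']; rfl
      omega
  · -- completeness
    set r := x.1.2.toNat with hrdef
    have hrz : (r : ℤ) = x.1.2 := Int.toNat_of_nonneg hxm
    have hr : r < w.length := by
      have : (r : ℤ) < ((wordZ w).length : ℤ) := by rw [hrz]; exact hxp
      rw [length_wordZ] at this; exact_mod_cast this
    have hx : x = (((0 : Cell 2), (r : ℤ)), x.2) := Prod.ext (Prod.ext hx0 hrz.symm) rfl
    obtain ⟨hlen, hsort, h0, hL⟩ := hcuts r hr
    rw [hx] at hxlo hxhi
    obtain ⟨s, hs, c, hc, hcx⟩ := residue_complete hw2 hp (by omega) hMB hlen hsort (by rw [hL]; exact hGBz) (by rw [hL]; exact hMBz)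
      (fun s hs => (hslab r hr s hs).1) (fun s hs => (hslab r hr s hs).2.1) (fun s hs => (hslab r hr s hs).2.2) x.2
      (by rw [h0]; exact hxlo) (by rw [hL]; exact hxhi)
    refine ⟨decodeChord r c, ?_, by rw [hcx, ← hx]⟩
    unfold slabData
    refine List.mem_flatMap.mpr ⟨r, List.mem_range.mpr hr, List.mem_flatMap.mpr ⟨s, List.mem_range.mpr (by omega), ?_⟩⟩
    exact List.mem_map.mpr ⟨c, hc, rfl⟩
  · -- tables
    have hpow : (0 : ℝ) < 2 ^ E := by positivity
    obtain ⟨hR, hN⟩ := theta_flatMap_range (wordZ w)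
      (fun r => (List.range ((cuts r).length - 1)).flatMap fun s => (cs r s).map (decodeChord r)) k w.length
    have hRs := fun r => (theta_flatMap_range (wordZ w) (fun s => (cs r s).map (decodeChord r)) k ((cuts r).length - 1)).1
    have hNs := fun r => (theta_flatMap_range (wordZ w) (fun s => (cs r s).map (decodeChord r)) k ((cuts r).length - 1)).2
    unfold slabData slabTR slabTN
    constructor
    · rw [hR]
      push_cast
      rw [Finset.sum_div]
      refine Finset.sum_le_sum fun r hr => ?_
      rw [Finset.mem_range] at hr
      rw [hRs r, Finset.sum_div]
      refine Finset.sum_le_sum fun s hs => ?_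
      rw [Finset.mem_range] at hs
      exact slab_thetaR0_le hw hp (by omega) hP9 (by positivity) (hne r hr s (by omega)) (hslab r hr s (by omega)).1 k
    · rw [hN]
      push_cast
      rw [Finset.sum_div]
      refine Finset.sum_le_sum fun r hr => ?_
      rw [Finset.mem_range] at hr
      rw [hNs r, Finset.sum_div]
      refine Finset.sum_le_sum fun s hs => ?_
      rw [Finset.mem_range] at hs
      exact slab_thetaN0_le hw hp (by omega) hP9 (by positivity) (hne r hr s (by omega)) (hslab r hr s (by omega)).1 k

end Summit.AtomisticToContinuum.Crystallization.Theorems.ChartedZeroExcessLayeredLatticeLiouville.ThetaKernel
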